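import Summits.QuantumFields.YangMills.Theorems.LuscherReductionOneSiteLevelsIMS
import Summits.QuantumFields.YangMills.Theorems.FemtoTransferGapRungW1up

/-!
# The IMS localisation error of the one-site transfer form is `O(1/(Bℓ²))·c(B)³` — the defect-row bound
# (support module for the registered stub `stub_absUpper` of crux `OneSiteLevels`, route `LuscherReduction`, item stmt-QuantumFields-20007;
# fleet lead prover ym-luscher-20007-p1; line card `Lines/energy-lower-abs.md` (I2)/(I3))

`Theorems/LuscherReductionOneSiteLevelsIMS.lean` (EL1) reduces an upper bound on `⟨ψ,K_Bψ⟩` to bounds on the localised pieces `⟨J_aψ,K_BJ_aψ⟩`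
plus the error `½ M ‖ψ‖²`, where `M` bounds the DEFECT ROWS `∫ K_B(U,V) Σ_a (J_a(U) − J_a(V))² dV`.  This module bounds `M` for the
two-piece angular partitions `J₁ = cos Θ`, `J₂ = sin Θ` (automatically `J₁² + J₂² = 1`, and `Σ_a (J_a(U) − J_a(V))² ≤ (Θ(U) − Θ(V))²`,
`sum_fin_two_cos_sin_sub_sq_le`) driven by a LINK-LIPSCHITZ phase `Θ` (`|Θ(U) − Θ(V)| ≤ Λ Σ_e ‖U_e − V_e‖_F`, e.g. `Θ = (π/2)(1 − Π_e χ(vacDist(U_e)/ℓ))`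
with `χ` 1-Lipschitz, `Λ = π/(2ℓ)`), in the language of the W1-up chain (`linkW`, `linkC`, `linkM2`, `linkE`, `linkCE`, planner ym-beyond-p1 g13):

* `integral_linkE_mul_frobSq_eq` — the mixed row integral `∫ E_B(U,V) ‖U_eV_e⁻¹ − 1‖_F² dV = linkM2 B · linkC B ^ 2` (Fubini over the
  three Haar factors + translation invariance), for every `U` and every link `e`;
* `defectRow_le` — **`∫ K_B(U,V) (Θ(U) − Θ(V))² dV ≤ 9 Λ² · linkM2 B · linkC B ^ 2`** (`K_B ≤ E_B` since `S ≥ 0`; Cauchy–Schwarz over the three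
  links; `‖U_e − V_e‖_F = ‖U_eV_e⁻¹ − 1‖_F`);
* `defectRow_le_of_pos` — with the chain's Laplace bound `linkM2 B ≤ (cM2/B)·linkC B`: `≤ 9 Λ² (cM2/B) · linkCE B`;
* `qform_le_localized_cos_sin` — plugged into EL1: `⟨ψ,K_Bψ⟩ ≤ ⟨J₁ψ,K_BJ₁ψ⟩ + ⟨J₂ψ,K_BJ₂ψ⟩ + (9/2) Λ² (cM2/B) linkCE B · ‖ψ‖²` for every physical
  `ψ` and every measurable gauge- and twist-invariant link-Lipschitz phase `Θ`.
Scale bookkeeping (card (I3)): cut-offs at link scale `ℓ` have `Λ ≍ 1/ℓ`, so the error is `≍ linkCE/(Bℓ²)`; at `ℓ² ≍ λ_b` (`Bλ_b³ = 2`) this is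
`O(λ_b²)·linkCE B`, inside the `Cλ_b²` slack of `OneSiteAbsUpper` (`defect_scale`, with the chain's `bareLambda_cube`).

## WHAT THIS IS NOT
No choice of `Θ` is made and no bound on the localised pieces is proved (those are the outer bound and the inner comparison of the card);
NOT the crux, NOT THE CLAY GAP.  Sorry-free; no new definition, no named fact.
-/

set_option autoImplicit false

noncomputable section

open MeasureTheory Filter Topology Real
open scoped Matrix ComplexConjugate BigOperators
open Literature.MathematicalPhysics.QuantumFieldTheory
open Literature.MathematicalPhysics.QuantumLattice

namespace Summit.QuantumFields.YangMills.Theorems.FemtoTransferGap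

/-! ### §1. Angular two-piece partitions: `Σ_a (J_a(U) − J_a(V))² ≤ (Θ(U) − Θ(V))²` -/

/-- The angular partition `J 0 = cos ∘ Θ`, `J 1 = sin ∘ Θ` indexed by `Fin 2` (no new definition: a local abbreviation as a function). -/
theorem sum_fin_two_cos_sin_sq (Θ : Cfg → ℝ) (U : Cfg) :
    ∑ a : Fin 2, (![Real.cos (Θ U), Real.sin (Θ U)] a) ^ 2 = 1 := by
  simp [Fin.sum_univ_two, Real.cos_sq_add_sin_sq]

/-- `Σ_a (J_a(U) − J_a(V))² ≤ (Θ(U) − Θ(V))²` for the angular partition. [folklore] -/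
theorem sum_fin_two_cos_sin_sub_sq_le (Θ : Cfg → ℝ) (U V : Cfg) :
    ∑ a : Fin 2, (![Real.cos (Θ U), Real.sin (Θ U)] a - ![Real.cos (Θ V), Real.sin (Θ V)] a) ^ 2 ≤ (Θ U - Θ V) ^ 2 := by
  simp only [Fin.sum_univ_two, Matrix.cons_val_zero, Matrix.cons_val_one]
  -- `(cos a − cos b)² + (sin a − sin b)² = 2 − 2cos(a − b) ≤ (a − b)²`
  have h1 : (Real.cos (Θ U) - Real.cos (Θ V)) ^ 2 + (Real.sin (Θ U) - Real.sin (Θ V)) ^ 2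
      = 2 - 2 * Real.cos (Θ U - Θ V) := by
    rw [Real.cos_sub]
    nlinarith [Real.cos_sq_add_sin_sq (Θ U), Real.cos_sq_add_sin_sq (Θ V)]
  rw [h1]
  have h2 := Real.one_sub_sq_div_two_le_cos (x := Θ U - Θ V)
  linarith

/-! ### §2. The mixed row integral `∫ E_B(U,V) ‖U_eV_e⁻¹ − 1‖² dV = linkM2 · linkC²` -/

/-- Per-link factor functions of the mixed row integrand: `w_B(U_{e'}v⁻¹)`, times `‖U_e v⁻¹ − 1‖_F²` on the marked link. -/
theorem integral_markedFactor_eq (B : ℝ) (U : Cfg) (e e' : Edge 3 1) :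
    ∫ v, linkW B (U e' * v⁻¹) * (if e' = e then frobNorm (((U e' * v⁻¹ : SU2) : Matrix (Fin 2) (Fin 2) ℂ) - 1) ^ 2 else 1)
        ∂haarProbability SU2
      = if e' = e then linkM2 B else linkC B := by
  split_ifs with h
  · rw [linkM2]
    have := integral_comp_mul_inv_left
      (fun W : SU2 => frobNorm ((W : Matrix (Fin 2) (Fin 2) ℂ) - 1) ^ 2 * linkW B W) (U e')
    rw [← this]
    refine integral_congr_ae (ae_of_all _ fun v => ?_)
    simp only
    ring
  · simp only [mul_one]
    rw [linkC]
    exact integral_comp_mul_inv_left (linkW B) (U e')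

/-- **Mixed row integral**: `∫ E_B(U,V) ‖U_eV_e⁻¹ − 1‖_F² dV = linkM2 B · linkC B ^ 2` for every `U` and every link `e`
(Fubini over the product Haar measure, translation invariance link by link; `|Edge 3 1| = 3`). [folklore] -/
theorem integral_linkE_mul_frobSq_eq (B : ℝ) (U : Cfg) (e : Edge 3 1) :
    ∫ V, linkE B U V * frobNorm (((U e * (V e)⁻¹ : SU2) : Matrix (Fin 2) (Fin 2) ℂ) - 1) ^ 2 ∂configMeasure SU2 1
      = linkM2 B * linkC B ^ 2 := by
  have hfac : ∀ V : Cfg, linkE B U V * frobNorm (((U e * (V e)⁻¹ : SU2) : Matrix (Fin 2) (Fin 2) ℂ) - 1) ^ 2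
      = ∏ e' : Edge 3 1, (linkW B (U e' * (V e')⁻¹) *
          (if e' = e then frobNorm (((U e' * (V e')⁻¹ : SU2) : Matrix (Fin 2) (Fin 2) ℂ) - 1) ^ 2 else 1)) := by
    intro V
    rw [Finset.prod_mul_distrib, linkE]
    congr 1
    rw [Finset.prod_ite_eq' Finset.univ e]
    simp
  simp_rw [hfac]
  rw [show (∫ V, ∏ e' : Edge 3 1, (linkW B (U e' * (V e')⁻¹) *
          (if e' = e then frobNorm (((U e' * (V e')⁻¹ : SU2) : Matrix (Fin 2) (Fin 2) ℂ) - 1) ^ 2 else 1)) ∂configMeasure SU2 1)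
      = ∏ e' : Edge 3 1, ∫ v, linkW B (U e' * v⁻¹) *
          (if e' = e then frobNorm (((U e' * v⁻¹ : SU2) : Matrix (Fin 2) (Fin 2) ℂ) - 1) ^ 2 else 1) ∂haarProbability SU2 from
    integral_fintype_prod_eq_prod (fun e' v => linkW B (U e' * v⁻¹) *
      (if e' = e then frobNorm (((U e' * v⁻¹ : SU2) : Matrix (Fin 2) (Fin 2) ℂ) - 1) ^ 2 else 1))]
  simp_rw [integral_markedFactor_eq]
  rw [← Finset.mul_prod_erase Finset.univ _ (Finset.mem_univ e), if_pos rfl,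
    Finset.prod_congr rfl (fun x hx => if_neg (Finset.ne_of_mem_erase hx)), Finset.prod_const,
    Finset.card_erase_of_mem (Finset.mem_univ e), Finset.card_univ, card_edge_one]

/-! ### §3. The defect-row bound -/

/-- Cauchy–Schwarz over the three links: `(Σ_e a_e)² ≤ 3 Σ_e a_e²`. [folklore] -/
theorem sq_sum_edge_le (a : Edge 3 1 → ℝ) : (∑ e, a e) ^ 2 ≤ 3 * ∑ e, a e ^ 2 := by
  have h := sq_sum_le_card_mul_sum_sq (s := (Finset.univ : Finset (Edge 3 1))) (f := a)
  rw [Finset.card_univ, card_edge_one] at h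
  exact_mod_cast h

/-- **Defect-row bound.**  If the phase `Θ` is link-Lipschitz, `|Θ(U) − Θ(V)| ≤ Λ Σ_e ‖U_e − V_e‖_F`, then for `B ≥ 0` and
every `U`: `∫ K_B(U,V) (Θ(U) − Θ(V))² dV ≤ 9 Λ² · linkM2 B · linkC B ^ 2` (`K_B ≤ E_B`, Cauchy–Schwarz over the links,
`‖U_e − V_e‖_F = ‖U_eV_e⁻¹ − 1‖_F`, and the mixed row integral of §2). [folklore] -/
theorem defectRow_le {B : ℝ} (hB : 0 ≤ B) {Θ : Cfg → ℝ} {Λ : ℝ}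
    (hLip : ∀ U V : Cfg, |Θ U - Θ V| ≤ Λ * ∑ e, frobNorm ((U e : Matrix (Fin 2) (Fin 2) ℂ) - (V e : Matrix (Fin 2) (Fin 2) ℂ)))
    (U : Cfg) :
    ∫ V, transferKernel su2Rep B U V * (Θ U - Θ V) ^ 2 ∂configMeasure SU2 1 ≤ 9 * Λ ^ 2 * (linkM2 B * linkC B ^ 2) := by
  -- pointwise: K (ΔΘ)² ≤ E · 3Λ² Σ_e ‖U_eV_e⁻¹ − 1‖²
  have hpt : ∀ V : Cfg, transferKernel su2Rep B U V * (Θ U - Θ V) ^ 2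
      ≤ (3 * Λ ^ 2) * ∑ e, linkE B U V * frobNorm (((U e * (V e)⁻¹ : SU2) : Matrix (Fin 2) (Fin 2) ℂ) - 1) ^ 2 := by
    intro V
    have h1 : (Θ U - Θ V) ^ 2 ≤ Λ ^ 2 * (3 * ∑ e, frobNorm (((U e * (V e)⁻¹ : SU2) : Matrix (Fin 2) (Fin 2) ℂ) - 1) ^ 2) := by
      have hL := hLip U V
      have h0 : 0 ≤ ∑ e, frobNorm ((U e : Matrix (Fin 2) (Fin 2) ℂ) - (V e : Matrix (Fin 2) (Fin 2) ℂ)) :=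
        Finset.sum_nonneg fun e _ => frobNorm_nonneg _
      have h2 : (Θ U - Θ V) ^ 2 ≤ (Λ * ∑ e, frobNorm ((U e : Matrix (Fin 2) (Fin 2) ℂ) - (V e : Matrix (Fin 2) (Fin 2) ℂ))) ^ 2 := by
        rw [← sq_abs (Θ U - Θ V)]
        exact pow_le_pow_left₀ (abs_nonneg _) hL 2
      have h3 := sq_sum_edge_le fun e => frobNorm ((U e : Matrix (Fin 2) (Fin 2) ℂ) - (V e : Matrix (Fin 2) (Fin 2) ℂ))
      simp only [frobNorm_sub_eq_mul_inv] at h3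
      calc (Θ U - Θ V) ^ 2 ≤ Λ ^ 2 * (∑ e, frobNorm ((U e : Matrix (Fin 2) (Fin 2) ℂ) - (V e : Matrix (Fin 2) (Fin 2) ℂ))) ^ 2 := by
            rw [mul_pow] at h2; exact h2
        _ ≤ Λ ^ 2 * (3 * ∑ e, frobNorm (((U e * (V e)⁻¹ : SU2) : Matrix (Fin 2) (Fin 2) ℂ) - 1) ^ 2) := by
            refine mul_le_mul_of_nonneg_left ?_ (sq_nonneg _)
            have : (∑ e, frobNorm ((U e : Matrix (Fin 2) (Fin 2) ℂ) - (V e : Matrix (Fin 2) (Fin 2) ℂ))) ^ 2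
                = (∑ e, frobNorm (((U e * (V e)⁻¹ : SU2) : Matrix (Fin 2) (Fin 2) ℂ) - 1)) ^ 2 := by
              congr 1
              exact Finset.sum_congr rfl fun e _ => frobNorm_sub_eq_mul_inv _ _
            rw [this]
            exact h3
    have hK := transferKernel_le_linkE hB U V
    have hK0 := (transferKernel_pos su2Rep B U V).le
    calc transferKernel su2Rep B U V * (Θ U - Θ V) ^ 2
        ≤ linkE B U V * (Λ ^ 2 * (3 * ∑ e, frobNorm (((U e * (V e)⁻¹ : SU2) : Matrix (Fin 2) (Fin 2) ℂ) - 1) ^ 2)) :=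
          mul_le_mul hK h1 (sq_nonneg _) (linkE_pos B U V).le
      _ = (3 * Λ ^ 2) * ∑ e, linkE B U V * frobNorm (((U e * (V e)⁻¹ : SU2) : Matrix (Fin 2) (Fin 2) ℂ) - 1) ^ 2 := by
          rw [← Finset.mul_sum]
          ring
  -- integrability of the majorant terms
  haveI := secondCountableTopology_su2
  have hint : ∀ e : Edge 3 1, Integrable (fun V : Cfg =>
      linkE B U V * frobNorm (((U e * (V e)⁻¹ : SU2) : Matrix (Fin 2) (Fin 2) ℂ) - 1) ^ 2) (configMeasure SU2 1) := by
    intro e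
    have hm : Measurable fun V : Cfg => linkE B U V * frobNorm (((U e * (V e)⁻¹ : SU2) : Matrix (Fin 2) (Fin 2) ℂ) - 1) ^ 2 := by
      refine ((measurable_linkE B).comp (measurable_const.prodMk measurable_id)).mul ?_
      have h1 : Measurable fun v : SU2 => frobNorm ((((U e) * v⁻¹ : SU2) : Matrix (Fin 2) (Fin 2) ℂ) - 1) ^ 2 :=
        ((continuous_frobNorm'.comp ((continuous_subtype_val.comp (continuous_const.mul continuous_inv)).sub
          continuous_const)).pow 2).measurable
      exact h1.comp (measurable_pi_apply e)
    refine Integrable.mono' (integrable_const (Real.exp (2 * B) ^ Fintype.card (Edge 3 1) * 8))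
      hm.aestronglyMeasurable (ae_of_all _ fun V => ?_)
    rw [Real.norm_eq_abs, abs_mul, abs_of_pos (linkE_pos B U V), abs_of_nonneg (sq_nonneg _)]
    exact mul_le_mul (linkE_le hB U V) (frobNorm_sub_one_sq_le_eight _) (sq_nonneg _) (by positivity)
  calc ∫ V, transferKernel su2Rep B U V * (Θ U - Θ V) ^ 2 ∂configMeasure SU2 1
      ≤ ∫ V, (3 * Λ ^ 2) * ∑ e, linkE B U V * frobNorm (((U e * (V e)⁻¹ : SU2) : Matrix (Fin 2) (Fin 2) ℂ) - 1) ^ 2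
          ∂configMeasure SU2 1 := by
        refine integral_mono_of_nonneg (ae_of_all _ fun V => ?_)
          ((integrable_finsetSum _ fun e _ => hint e).const_mul _) (ae_of_all _ hpt)
        exact mul_nonneg (transferKernel_pos su2Rep B U V).le (sq_nonneg _)
    _ = (3 * Λ ^ 2) * ∑ e : Edge 3 1, linkM2 B * linkC B ^ 2 := by
        rw [integral_const_mul, integral_finsetSum _ fun e _ => hint e]
        congr 1
        exact Finset.sum_congr rfl fun e _ => integral_linkE_mul_frobSq_eq B U e
    _ = 9 * Λ ^ 2 * (linkM2 B * linkC B ^ 2) := by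
        rw [Finset.sum_const, Finset.card_univ, card_edge_one, nsmul_eq_mul]
        ring

/-- The defect-row bound with the Laplace estimate `linkM2 B ≤ (cM2/B) linkC B` of the W1-up chain (`B > 0`):
`∫ K_B(U,V) (Θ(U) − Θ(V))² dV ≤ 9 Λ² (cM2/B) · linkCE B`. [folklore] -/
theorem defectRow_le_of_pos {B : ℝ} (hB : 0 < B) {Θ : Cfg → ℝ} {Λ : ℝ}
    (hLip : ∀ U V : Cfg, |Θ U - Θ V| ≤ Λ * ∑ e, frobNorm ((U e : Matrix (Fin 2) (Fin 2) ℂ) - (V e : Matrix (Fin 2) (Fin 2) ℂ)))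
    (U : Cfg) :
    ∫ V, transferKernel su2Rep B U V * (Θ U - Θ V) ^ 2 ∂configMeasure SU2 1 ≤ 9 * Λ ^ 2 * (cM2 / B) * linkCE B := by
  have h := defectRow_le hB.le hLip U
  have hM := linkM2_le hB
  have hc := (linkC_pos hB.le).le
  have hCE : linkCE B = linkC B ^ 3 := by rw [linkCE, card_edge_one]
  calc ∫ V, transferKernel su2Rep B U V * (Θ U - Θ V) ^ 2 ∂configMeasure SU2 1 ≤ 9 * Λ ^ 2 * (linkM2 B * linkC B ^ 2) := h
    _ ≤ 9 * Λ ^ 2 * (cM2 / B * linkC B * linkC B ^ 2) := by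
        refine mul_le_mul_of_nonneg_left (mul_le_mul_of_nonneg_right hM (sq_nonneg _)) (by positivity)
    _ = 9 * Λ ^ 2 * (cM2 / B) * linkCE B := by rw [hCE]; ring

/-! ### §4. Plugged into the IMS inequality (EL1) -/

/-- **IMS with an angular two-piece partition driven by a link-Lipschitz physical phase.**  For `B > 0`, a measurable, gauge- and
twist-invariant phase `Θ` with `|Θ(U) − Θ(V)| ≤ Λ Σ_e ‖U_e − V_e‖_F`, and every physical `ψ`:
`⟨ψ,K_Bψ⟩ ≤ ⟨(cos Θ)ψ, K_B (cos Θ)ψ⟩ + ⟨(sin Θ)ψ, K_B (sin Θ)ψ⟩ + (9/2) Λ² (cM2/B) linkCE B ‖ψ‖²`. [cite: SimonB1983DiscreteSpectrum, §3] -/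
theorem qform_le_localized_cos_sin {B : ℝ} (hB : 0 < B) {Θ : Cfg → ℝ} (hΘm : Measurable Θ) {Λ : ℝ} (hΛ : 0 ≤ Λ)
    (hLip : ∀ U V : Cfg, |Θ U - Θ V| ≤ Λ * ∑ e, frobNorm ((U e : Matrix (Fin 2) (Fin 2) ℂ) - (V e : Matrix (Fin 2) (Fin 2) ℂ)))
    (hΘg : ∀ (g : Site 3 1 → SU2) (U : Cfg), Θ (gaugeTransform g U) = Θ U)
    (hΘz : ∀ (k : Fin 3), ∀ z ∈ Subgroup.center SU2, ∀ U : Cfg, Θ (twist k z U) = Θ U)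
    {ψ : Cfg → ℝ} (hψ : IsPhys ψ) :
    qform su2Rep B ψ ψ ≤ qform su2Rep B (fun U => Real.cos (Θ U) * ψ U) (fun U => Real.cos (Θ U) * ψ U)
      + qform su2Rep B (fun U => Real.sin (Θ U) * ψ U) (fun U => Real.sin (Θ U) * ψ U)
      + (1 / 2) * (9 * Λ ^ 2 * (cM2 / B) * linkCE B) * l2 ψ ψ := by
  set J : Fin 2 → Cfg → ℝ := fun a U => ![Real.cos (Θ U), Real.sin (Θ U)] a with hJ
  have hJm : ∀ a, Measurable (J a) := by
    intro a
    fin_cases a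
    · exact Real.continuous_cos.measurable.comp hΘm
    · exact Real.continuous_sin.measurable.comp hΘm
  have hJsum : ∀ U, ∑ a, J a U ^ 2 = 1 := fun U => sum_fin_two_cos_sin_sq Θ U
  have hJg : ∀ a (g : Site 3 1 → SU2) (U : Cfg), J a (gaugeTransform g U) = J a U := by
    intro a g U; simp only [hJ, hΘg g U]
  have hJz : ∀ a (k : Fin 3), ∀ z ∈ Subgroup.center SU2, ∀ U : Cfg, J a (twist k z U) = J a U := by
    intro a k z hz U; simp only [hJ, hΘz k z hz U]
  have hM : ∀ U : Cfg, ∫ V, transferKernel su2Rep B U V * ∑ a, (J a U - J a V) ^ 2 ∂configMeasure SU2 1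
      ≤ 9 * Λ ^ 2 * (cM2 / B) * linkCE B := by
    intro U
    refine le_trans ?_ (defectRow_le_of_pos hB hLip U)
    haveI := secondCountableTopology_su2
    refine integral_mono_of_nonneg (ae_of_all _ fun V => ?_) ?_ (ae_of_all _ fun V => ?_)
    · exact mul_nonneg (transferKernel_pos su2Rep B U V).le (Finset.sum_nonneg fun a _ => sq_nonneg _)
    · -- integrable majorant: bounded measurable on a probability space
      have hm : Measurable fun V : Cfg => transferKernel su2Rep B U V * (Θ U - Θ V) ^ 2 :=
        ((measurable_transferKernel_su2 B).comp (measurable_const.prodMk measurable_id)).mul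
          ((measurable_const.sub hΘm).pow_const 2)
      obtain ⟨Mk, hMk⟩ := exists_transferKernel_le su2Rep continuous_su2Rep B (L := 1)
      -- `(Θ U − Θ V)² ≤ (Λ Σ_e ‖U_e − V_e‖)² ≤ (Λ · 3 · 2√2)²`-type bound: use `‖·‖_F ≤ √8`
      have hbd : ∀ V : Cfg, (Θ U - Θ V) ^ 2 ≤ (Λ * (3 * Real.sqrt 8)) ^ 2 := by
        intro V
        have hL := hLip U V
        have hs : ∑ e, frobNorm ((U e : Matrix (Fin 2) (Fin 2) ℂ) - (V e : Matrix (Fin 2) (Fin 2) ℂ)) ≤ 3 * Real.sqrt 8 := by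
          have h8 : ∀ e : Edge 3 1, frobNorm ((U e : Matrix (Fin 2) (Fin 2) ℂ) - (V e : Matrix (Fin 2) (Fin 2) ℂ)) ≤ Real.sqrt 8 := by
            intro e
            rw [frobNorm_sub_eq_mul_inv]
            have h := frobNorm_sub_one_sq_le_eight (U e * (V e)⁻¹)
            rw [← Real.sqrt_le_sqrt_iff (by norm_num : (0:ℝ) ≤ 8)] at h
            rwa [Real.sqrt_sq (frobNorm_nonneg _)] at h
          calc ∑ e, frobNorm ((U e : Matrix (Fin 2) (Fin 2) ℂ) - (V e : Matrix (Fin 2) (Fin 2) ℂ))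
              ≤ ∑ _e : Edge 3 1, Real.sqrt 8 := Finset.sum_le_sum fun e _ => h8 e
            _ = 3 * Real.sqrt 8 := by rw [Finset.sum_const, Finset.card_univ, card_edge_one, nsmul_eq_mul]; norm_num
        have h1 : |Θ U - Θ V| ≤ Λ * (3 * Real.sqrt 8) := hL.trans (mul_le_mul_of_nonneg_left hs hΛ)
        rw [← sq_abs (Θ U - Θ V)]
        exact pow_le_pow_left₀ (abs_nonneg _) h1 2
      refine Integrable.mono' (integrable_const (Mk * (Λ * (3 * Real.sqrt 8)) ^ 2)) hm.aestronglyMeasurable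
        (ae_of_all _ fun V => ?_)
      rw [Real.norm_eq_abs, abs_mul, abs_of_pos (transferKernel_pos su2Rep B U V), abs_of_nonneg (sq_nonneg _)]
      exact mul_le_mul (hMk U V) (hbd V) (sq_nonneg _) ((transferKernel_pos su2Rep B U V).le.trans (hMk U V))
    · exact mul_le_mul_of_nonneg_left (sum_fin_two_cos_sin_sub_sq_le Θ U V) (transferKernel_pos su2Rep B U V).le
  have h := qform_su2Rep_le_sum_localized_add B J hJm hJsum hJg hJz hM hψ
  simp only [hJ, Fin.sum_univ_two, Matrix.cons_val_zero, Matrix.cons_val_one] at h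
  exact h

/-! ### §5. Scale bookkeeping: at `Λ² ≤ A/λ_b` the error is `O(λ_b²)·linkCE` -/

/-- Scale bookkeeping: if `Λ² ≤ A / λ_b` (cut-offs varying on link scale `ℓ ≍ λ_b^{1/2}`), the IMS error coefficient is
`9Λ²(cM2/B) ≤ (9/2)·A·cM2·λ_b²` — inside the `Cλ_b²` slack of `OneSiteAbsUpper`. [cite: SimonB1983DiscreteSpectrum, §3] -/
theorem defect_scale {B Λ A : ℝ} (hB : 0 < B) (hA : Λ ^ 2 ≤ A / bareLambda B) :
    9 * Λ ^ 2 * (cM2 / B) ≤ (9 / 2) * A * cM2 * bareLambda B ^ 2 := by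
  have hl : 0 < bareLambda B := by
    unfold bareLambda; exact Real.rpow_pos_of_pos (by positivity) _
  have hcube := bareLambda_cube hB
  have hc0 : 0 < cM2 := cM2_pos
  -- `1/B = λ_b³/2`
  have hinv : cM2 / B = cM2 * bareLambda B ^ 3 / 2 := by
    field_simp
    nlinarith [hcube]
  rw [hinv]
  have h1 : Λ ^ 2 * bareLambda B ≤ A := by
    rwa [le_div_iff₀ hl] at hA
  have key := mul_le_mul_of_nonneg_left h1 (by positivity : (0:ℝ) ≤ 9 / 2 * cM2 * bareLambda B ^ 2)
  have e1 : 9 * Λ ^ 2 * (cM2 * bareLambda B ^ 3 / 2) = 9 / 2 * cM2 * bareLambda B ^ 2 * (Λ ^ 2 * bareLambda B) := by ring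
  have e2 : (9 : ℝ) / 2 * A * cM2 * bareLambda B ^ 2 = 9 / 2 * cM2 * bareLambda B ^ 2 * A := by ring
  rw [e1, e2]
  exact key

end Summit.QuantumFields.YangMills.Theorems.FemtoTransferGap

end
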